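import Literature.Probability.RandomPlanarGeometry.HexSAWSurfaceWallRenewalCensusEngine
import Literature.Probability.RandomPlanarGeometry.HexSAWSurfaceWallRenewalEighthExact
import Literature.Probability.RandomPlanarGeometry.HexSAWSurfaceWallRenewalCensusNineA
import HarnessLib

/-!
# The order-NINE diagonal census of the adsorbed honeycomb walk, part B (by the counting engine):
# `N₁₁,₂ = 295`, `N₁₂,₃ = 132`, `N₁₃,₄ = 16`, and `N₁₁,₁ = 738`; the row `s = 11` complete: `Λ₂₂(y) = 738y + 295y² + 33y³`, `#(ipwb 22) = 1066`

Topic `Literature/Probability/RandomPlanarGeometry` (lane «pcv-sawmu», a-p6 g21, car «CENSUS-NINE-B»; parents: this seat's «CENSUS-ENGINE»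
(`HexSAWSurfaceWallRenewalCensusEngine`: ★ `WCount.card_filter_visits_ipwb_eq_length_census : #{ω ∈ ipwb N | visits = V} = (WCount.census N V).length`,
symbolic even `N ≥ 1`, `V`), and «A7-EXACT» (`HexSAWSurfaceWallRenewalEighthExact`, for the two diagonal-eight class numbers `N₁₁,₃ = 33`
(«CENSUS-EIGHT-B2») and `N₁₂,₄ = 1` («SIX-STEP-RIGIDITY») used to close the rows `s = 11, 12`)).

`N_{s,v} = #{ω ∈ ipwb (2s) : visits = v}` are the class numbers of the wall-renewal census (irreducible positive wall bridges of the adsorbing honeycomb walk by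
half-length and surface visits).  The diagonal `s − v = 9` has the four classes `(10,1), (11,2), (12,3), (13,4)`; `N₁₀,₁ = 267` is «CENSUS-NINE-A» (car 72's
table-certified pattern: two table modules of 250 KB and a certificate).  This module certifies the OTHER THREE by the counting engine — one `decide +kernel` each,
NO tables — and, at the same price, the first class `N₁₁,₁ = 738` of the diagonal `s − v = 10`, which closes the row `s = 11`:

* §0 (lane lemmas for the engine, namespace `WCount`) SPLITTING a census over the depth-`k` prefixes of the search: `kids`, `length_grow_succ`, `expand`,
  `sum_length_grow_eq_expand`, ★ `length_census_eq_sum_range : #census N V = Σ_{i<n} (expand …)[i]?.elim 0 (#grow (N − k) ·)` — each summand its own kernel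
  evaluation (the farm's kernel memory guard tripped twice on the single-shot `(26,4)` census of `103 674` nodes; pieces ≤ `55 000` nodes never did).
* §1 ★★★ `card_twoVisit_ipwb_twentytwo_eq : N₁₁,₂ = 295` (`23 239` search nodes), ★★★ `card_threeVisit_ipwb_twentyfour_eq : N₁₂,₃ = 132` (`54 828`),
  ★★★ `card_fourVisit_ipwb_twentysix_eq : N₁₃,₄ = 16` (`103 674` nodes as SEVEN depth-five pieces `10 + 0 + 6 + 0 + 0 + 0 + 0`; the sixteen are a-idea-1 g36's five
  slack-two families of «SLACK-TWO FAMILIES», whose `two_add_sum_sq_le_card_filter_visits` gave `≥ 16`), ★★ `card_oneVisit_ipwb_twentytwo_eq : N₁₁,₁ = 738` (`17 727`).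
* §2 the fibre decompositions `Λ_m(y) = Σ_{v ≤ K} N_{m,v} y^v` (private twin of the identity module's), `card_ipwb_eq_sum_range_card`,
  and the row `s = 11`: ★★★ `IPWB_twentytwo_eq_exact : Λ₂₂(y) = 738y + 295y² + 33y³`, ★★ `card_ipwb_twentytwo_eq : #(ipwb 22) = 1066`,
  ★★ `pwbLaw_eleven_eq_exact : f₁₁ = (738y + 295y² + 33y³)/β²²` — **the renewal law is explicit through half-length ELEVEN**.
* §3 the rows `s = 12, 13` with their diagonal-`≥ 10` classes symbolic: `IPWB_twentyfour_eq_census : Λ₂₄ = N₁₂,₁y + N₁₂,₂y² + 132y³ + y⁴`,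
  `IPWB_twentysix_eq_census : Λ₂₆ = N₁₃,₁y + N₁₃,₂y² + N₁₃,₃y³ + 16y⁴` (visit bounds `v ≤ 4` from the six-step law `6·visits ≤ n`, car 71).

With «CENSUS-NINE-A» the diagonal `s − v = 9` is COMPLETE: `267 + 295 + 132 + 16 = 710`; the ninth `β²`-coefficient `a₈` follows by the order-eight template
(«NINTH-CENSUS-IDENTITY», separate car).  NOT claimed here: `a₈`; the diagonal-ten classes other than `N₁₁,₁`; anything asymptotic.  Label (lane): LANE CENSUS
(kernel, by the verified engine) ⊕ LANE LEMMAS, DERIVED/computed; budget lines: 10 (`set_option maxHeartbeats 4000000 in` before each kernel census / piece — the lane's census-cell budget; measured kernel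
times ≈ 20 / 25 / 55 s and ≤ 40 s per `(26,4)` piece).  Sources: [MadrasSlade1993, Section 4.2, Definition 4.2.1, (4.2.2), (4.2.4), Theorem 4.2.2 (pp. 91–92)], [Kesten1963SAW, Section 4],
[EntingJensen2009, Section 7.4.2, Fig. 7.10], [BeatonBousquetMelouDeGierDuminilCopinGuttmann2014, Section 3.1 (arXiv v5 p. 8)].
-/

namespace Literature.Probability.RandomPlanarGeometry.SAW.HexBW.Wall

open Finset Function Census
open Literature.Probability.LatticeModels

variable {y : ℝ}

/-! ### §0  Splitting the engine's search over prefixes (lane lemmas for the counting engine) -/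

namespace WCount

/-- The valid children of a search state, in the engine's order (right, left, vertical), each with its extended reversed prefix.
[cite: MadrasSlade1993, Section 4.2, Definition 4.2.1] -/
def kids (V B r : ℕ) (s : St) (l : List (ℤ × ℤ)) : List (St × List (ℤ × ℤ)) :=
  match s with
  | (x, d, _, _, _, _, _) =>
    (bif ok V B r (x + 1) d s then [(advance B r (x + 1) d s, site (x + 1) d :: l)] else []) ++
    (bif ok V B r (x - 1) d s then [(advance B r (x - 1) d s, site (x - 1) d :: l)] else []) ++
    (bif Nat.beq ((x + d) % 2) 0 then
      (bif Nat.ble 1 d then (bif ok V B r x (d - 1) s then [(advance B r x (d - 1) s, site x (d - 1) :: l)] else []) else [])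
     else (bif ok V B r x (d + 1) s then [(advance B r x (d + 1) s, site x (d + 1) :: l)] else []))

/-- One level of the search as a sum over the children: `#grow (r+1) s l = Σ_{(s', l') ∈ kids} #grow r s' l'`.
[cite: MadrasSlade1993, Section 4.2, Definition 4.2.1] -/
theorem length_grow_succ (V B r : ℕ) (s : St) (l : List (ℤ × ℤ)) :
    (grow V B (r + 1) s l).length = ((kids V B r s l).map fun p => (grow V B r p.1 p.2).length).sum := by
  obtain ⟨x, d, mask, n, v, mx, pend⟩ := s
  have hc : ∀ x' d' : ℕ, (child V B r x' d' (x, d, mask, n, v, mx, pend) l fun s' l' => grow V B r s' l').length =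
      ((bif ok V B r x' d' (x, d, mask, n, v, mx, pend) then
        [(advance B r x' d' (x, d, mask, n, v, mx, pend), site x' d' :: l)] else []).map
        fun p => (grow V B r p.1 p.2).length).sum := by
    intro x' d'
    unfold child
    cases ok V B r x' d' (x, d, mask, n, v, mx, pend) <;> simp
  rw [grow, kids]
  simp only [List.length_append, List.map_append, List.sum_append, hc]
  cases Nat.beq ((x + d) % 2) 0 <;> cases Nat.ble 1 d <;> simp [hc]

/-- `k` levels of the search from a list of (state, prefix) pairs with `r` steps to go at the top. [cite: MadrasSlade1993, Section 4.2, Definition 4.2.1] -/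
def expand (V B : ℕ) : ℕ → ℕ → List (St × List (ℤ × ℤ)) → List (St × List (ℤ × ℤ))
  | 0, _, ps => ps
  | k + 1, r, ps => expand V B k (r - 1) (ps.flatMap fun p => kids V B (r - 1) p.1 p.2)

/-- Bookkeeping: a sum over a `flatMap`. [cite: MadrasSlade1993, Section 4.2, Definition 4.2.1] -/
theorem sum_map_flatMap_wc {α β : Type} (ps : List α) (g : α → List β) (f : β → ℕ) :
    ((ps.flatMap g).map f).sum = (ps.map fun p => ((g p).map f).sum).sum := by
  induction ps with
  | nil => simp
  | cons a t ih => simp [List.flatMap_cons, List.map_append, List.sum_append, ih]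

/-- ★ **The count below a list of prefixes is the count below their depth-`k` descendants.** [cite: MadrasSlade1993, Section 4.2, Definition 4.2.1] -/
theorem sum_length_grow_eq_expand (V B : ℕ) :
    ∀ (k r : ℕ) (ps : List (St × List (ℤ × ℤ))), k ≤ r →
      (ps.map fun p => (grow V B r p.1 p.2).length).sum =
        ((expand V B k r ps).map fun p => (grow V B (r - k) p.1 p.2).length).sum
  | 0, r, ps, _ => by simp [expand]
  | k + 1, r, ps, hk => by
    obtain ⟨r', rfl⟩ : ∃ r', r = r' + 1 := ⟨r - 1, by omega⟩
    rw [expand, Nat.add_sub_cancel, show r' + 1 - (k + 1) = r' - k by omega,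
      ← sum_length_grow_eq_expand V B k r' _ (by omega), sum_map_flatMap_wc]
    simp only [length_grow_succ]

/-- ★ **Splitting a census over the depth-`k` prefixes**: with `n` the number of prefixes,
`#census N V = Σ_{i < n} #grow (N − k) (prefix i)` — each summand a separate kernel evaluation (`Option.elim` keeps the others unevaluated).
[cite: MadrasSlade1993, Section 4.2, Definition 4.2.1, (4.2.2)] -/
theorem length_census_eq_sum_range (N V k : ℕ) (hk : k ≤ N) {n : ℕ}
    (hn : (expand V (N + 1) k N [(init (N + 1), [(0, 0)])]).length = n) :
    (census N V).length = ((List.range n).map fun i =>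
      ((expand V (N + 1) k N [(init (N + 1), [(0, 0)])])[i]?).elim 0 fun p => (grow V (N + 1) (N - k) p.1 p.2).length).sum := by
  have h := sum_length_grow_eq_expand V (N + 1) k N [(init (N + 1), [((0 : ℤ), (0 : ℤ))])] hk
  simp only [List.map_cons, List.map_nil, List.sum_cons, List.sum_nil, Nat.add_zero] at h
  rw [census, h, ← hn]
  set L := expand V (N + 1) k N [(init (N + 1), [((0 : ℤ), (0 : ℤ))])]
  -- `Σ f(L) = Σ_{i < |L|} f(L[i])`
  clear h hn hk
  induction L with
  | nil => simp
  | cons a t ih =>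
    rw [List.map_cons, List.sum_cons, List.length_cons, List.range_succ_eq_map, List.map_cons, List.sum_cons, List.map_map]
    rw [ih]
    rfl

end WCount

/-! ### §1  The four class numbers, by the counting engine -/

set_option maxHeartbeats 4000000 in
open Classical in
/-- ★★★ **`N₁₁,₂ = 295`**: exactly two hundred and ninety-five two-visit irreducible positive wall bridges of length twenty-two (symbolic length; engine census,
`23 239` search nodes). [cite: MadrasSlade1993, Section 4.2, Definition 4.2.1, (4.2.2)] [cite: Kesten1963SAW, Section 4] [cite: EntingJensen2009, Section 7.4.2, Fig. 7.10] -/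
theorem card_twoVisit_ipwb_twentytwo_eq {m : ℕ} (hm : m = 22) : #((ipwb m).filter fun ω => visits m ω = 2) = 295 := by
  subst hm
  rw [WCount.card_filter_visits_ipwb_eq_length_census (by norm_num) (by norm_num)]
  decide +kernel

set_option maxHeartbeats 4000000 in
open Classical in
/-- ★★★ **`N₁₂,₃ = 132`**: exactly one hundred and thirty-two three-visit irreducible positive wall bridges of length twenty-four (symbolic length; engine census,
`54 828` search nodes). [cite: MadrasSlade1993, Section 4.2, Definition 4.2.1, (4.2.2)] [cite: Kesten1963SAW, Section 4] [cite: EntingJensen2009, Section 7.4.2, Fig. 7.10] -/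
theorem card_threeVisit_ipwb_twentyfour_eq {m : ℕ} (hm : m = 24) : #((ipwb m).filter fun ω => visits m ω = 3) = 132 := by
  subst hm
  rw [WCount.card_filter_visits_ipwb_eq_length_census (by norm_num) (by norm_num)]
  decide +kernel

/-- The depth-five prefixes of the `(26, 4)` search are seven. [cite: MadrasSlade1993, Section 4.2, Definition 4.2.1] -/
theorem length_expand_twentysix_four : (WCount.expand 4 27 5 26 [(WCount.init 27, [(0, 0)])]).length = 7 := by decide

set_option maxHeartbeats 4000000 in
/-- Kernel count below the depth-five prefix no. 0 of the `(26, 4)` search (`38 666` nodes). [cite: MadrasSlade1993, Section 4.2, Definition 4.2.1, (4.2.2)] -/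
theorem piece_twentysix_four_0 : ((WCount.expand 4 27 5 26 [(WCount.init 27, [(0, 0)])])[0]?).elim 0
    (fun p => (WCount.grow 4 27 21 p.1 p.2).length) = 10 := by decide +kernel

set_option maxHeartbeats 4000000 in
/-- Kernel count below the depth-five prefix no. 1 (`23 152` nodes). [cite: MadrasSlade1993, Section 4.2, Definition 4.2.1, (4.2.2)] -/
theorem piece_twentysix_four_1 : ((WCount.expand 4 27 5 26 [(WCount.init 27, [(0, 0)])])[1]?).elim 0
    (fun p => (WCount.grow 4 27 21 p.1 p.2).length) = 0 := by decide +kernel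

set_option maxHeartbeats 4000000 in
/-- Kernel count below the depth-five prefix no. 2 (`8 533` nodes). [cite: MadrasSlade1993, Section 4.2, Definition 4.2.1, (4.2.2)] -/
theorem piece_twentysix_four_2 : ((WCount.expand 4 27 5 26 [(WCount.init 27, [(0, 0)])])[2]?).elim 0
    (fun p => (WCount.grow 4 27 21 p.1 p.2).length) = 6 := by decide +kernel

set_option maxHeartbeats 4000000 in
/-- Kernel count below the depth-five prefix no. 3 (`11 450` nodes). [cite: MadrasSlade1993, Section 4.2, Definition 4.2.1, (4.2.2)] -/
theorem piece_twentysix_four_3 : ((WCount.expand 4 27 5 26 [(WCount.init 27, [(0, 0)])])[3]?).elim 0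
    (fun p => (WCount.grow 4 27 21 p.1 p.2).length) = 0 := by decide +kernel

set_option maxHeartbeats 4000000 in
/-- Kernel count below the depth-five prefix no. 4 (`8 380` nodes). [cite: MadrasSlade1993, Section 4.2, Definition 4.2.1, (4.2.2)] -/
theorem piece_twentysix_four_4 : ((WCount.expand 4 27 5 26 [(WCount.init 27, [(0, 0)])])[4]?).elim 0
    (fun p => (WCount.grow 4 27 21 p.1 p.2).length) = 0 := by decide +kernel

set_option maxHeartbeats 4000000 in
/-- Kernel count below the depth-five prefix no. 5 (`10 965` nodes). [cite: MadrasSlade1993, Section 4.2, Definition 4.2.1, (4.2.2)] -/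
theorem piece_twentysix_four_5 : ((WCount.expand 4 27 5 26 [(WCount.init 27, [(0, 0)])])[5]?).elim 0
    (fun p => (WCount.grow 4 27 21 p.1 p.2).length) = 0 := by decide +kernel

set_option maxHeartbeats 4000000 in
/-- Kernel count below the depth-five prefix no. 6 (`2 518` nodes). [cite: MadrasSlade1993, Section 4.2, Definition 4.2.1, (4.2.2)] -/
theorem piece_twentysix_four_6 : ((WCount.expand 4 27 5 26 [(WCount.init 27, [(0, 0)])])[6]?).elim 0
    (fun p => (WCount.grow 4 27 21 p.1 p.2).length) = 0 := by decide +kernel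

open Classical in
/-- ★★★ **`N₁₃,₄ = 16`**: exactly sixteen four-visit irreducible positive wall bridges of length twenty-six — a-idea-1 g36's five slack-two families are ALL of the
class (symbolic length; engine census `103 674` nodes, split over the seven depth-five prefixes: `10 + 0 + 6 + 0 + 0 + 0 + 0`).
[cite: MadrasSlade1993, Section 4.2, Definition 4.2.1, (4.2.2)] [cite: Kesten1963SAW, Section 4] [cite: EntingJensen2009, Section 7.4.2, Fig. 7.10] -/
theorem card_fourVisit_ipwb_twentysix_eq {m : ℕ} (hm : m = 26) : #((ipwb m).filter fun ω => visits m ω = 4) = 16 := by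
  subst hm
  rw [WCount.card_filter_visits_ipwb_eq_length_census (by norm_num) (by norm_num),
    WCount.length_census_eq_sum_range 26 4 5 (by norm_num) length_expand_twentysix_four]
  simp only [List.range, List.range.loop, List.map_cons, List.map_nil, List.sum_cons, List.sum_nil, show 26 - 5 = 21 from rfl,
    show (26 : ℕ) + 1 = 27 from rfl, piece_twentysix_four_0, piece_twentysix_four_1, piece_twentysix_four_2, piece_twentysix_four_3, piece_twentysix_four_4,
    piece_twentysix_four_5, piece_twentysix_four_6]
  norm_num

set_option maxHeartbeats 4000000 in
open Classical in
/-- ★★ **`N₁₁,₁ = 738`**: exactly seven hundred and thirty-eight one-visit irreducible positive wall bridges of length twenty-two — the first class of the diagonal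
`s − v = 10` (symbolic length; engine census, `17 727` search nodes). [cite: MadrasSlade1993, Section 4.2, Definition 4.2.1, (4.2.2)] [cite: Kesten1963SAW, Section 4] [cite: EntingJensen2009, Section 7.4.2, Fig. 7.10] -/
theorem card_oneVisit_ipwb_twentytwo_eq {m : ℕ} (hm : m = 22) : #((ipwb m).filter fun ω => visits m ω = 1) = 738 := by
  subst hm
  rw [WCount.card_filter_visits_ipwb_eq_length_census (by norm_num) (by norm_num)]
  decide +kernel

/-! ### §2  Fibre decomposition and the row `s = 11` -/

open Classical in
/-- Fibre decomposition of the block polynomial: `Λ_m(y) = Σ_{v ≤ K} N_{m,v}·y^v` for any bound `K` on the surface visits of the blocks of length `m`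
(private twin of «NINTH-CENSUS-IDENTITY»'s public lemma, to keep this census module independent of it).
[cite: MadrasSlade1993, Section 4.2, (4.2.2) (p. 91)] [cite: BeatonBousquetMelouDeGierDuminilCopinGuttmann2014, Section 3.1 (arXiv v5 p. 8)] -/
private theorem IPWB_eq_sum_range_card_mul_pow_nb {m K : ℕ} (hK : ∀ ω ∈ ipwb m, visits m ω ≤ K) (y : ℝ) :
    IPWB m y = ∑ v ∈ Finset.range (K + 1), (#((ipwb m).filter fun ω => visits m ω = v) : ℝ) * y ^ v := by
  rw [IPWB, ← Finset.sum_fiberwise_of_maps_to (s := ipwb m) (t := Finset.range (K + 1)) (g := fun ω => visits m ω)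
    (fun ω hω => Finset.mem_range.2 (Nat.lt_succ_of_le (hK ω hω)))]
  refine Finset.sum_congr rfl fun v _ => ?_
  rw [Finset.sum_congr rfl fun ω hω => by rw [(Finset.mem_filter.1 hω).2], Finset.sum_const, nsmul_eq_mul]

open Classical in
/-- **Fibre decomposition of the block count**: `#(ipwb m) = Σ_{v ≤ K} N_{m,v}`. [cite: MadrasSlade1993, Section 4.2, Definition 4.2.1, (4.2.2)] -/
theorem card_ipwb_eq_sum_range_card {m K : ℕ} (hK : ∀ ω ∈ ipwb m, visits m ω ≤ K) :
    #(ipwb m) = ∑ v ∈ Finset.range (K + 1), #((ipwb m).filter fun ω => visits m ω = v) :=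
  Finset.card_eq_sum_card_fiberwise fun ω hω => Finset.mem_range.2 (Nat.lt_succ_of_le (hK ω hω))

open Classical in
/-- No block has zero visits (the final step is a visit; private twin). [cite: MadrasSlade1993, Section 4.2, Definition 4.2.1] [cite: BeatonBousquetMelouDeGierDuminilCopinGuttmann2014, Section 3.1 (arXiv v5 p. 8)] -/
private theorem card_zeroVisit_ipwb_eq_zero_nb (m : ℕ) : #((ipwb m).filter fun ω => visits m ω = 0) = 0 :=
  Finset.card_eq_zero.2 (Finset.filter_eq_empty_iff.2 fun ω hω h0 => by have := one_le_visits_of_mem_ipwb hω; omega)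

/-- Blocks of length twenty-two visit the surface at most three times (six-step law). [cite: MadrasSlade1993, Section 4.2, Definition 4.2.1] [cite: BeatonBousquetMelouDeGierDuminilCopinGuttmann2014, Section 3.1 (arXiv v5 p. 8)] -/
theorem visits_le_three_of_mem_ipwb_twentytwo {m : ℕ} (hm : m = 22) {ω : ℕ → Site 2} (hω : ω ∈ ipwb m) : visits m ω ≤ 3 := by
  have := six_mul_visits_le hω (by omega)
  omega

/-- Blocks of length twenty-four visit the surface at most four times (six-step law). [cite: MadrasSlade1993, Section 4.2, Definition 4.2.1] [cite: BeatonBousquetMelouDeGierDuminilCopinGuttmann2014, Section 3.1 (arXiv v5 p. 8)] -/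
theorem visits_le_four_of_mem_ipwb_twentyfour {m : ℕ} (hm : m = 24) {ω : ℕ → Site 2} (hω : ω ∈ ipwb m) : visits m ω ≤ 4 := by
  have := six_mul_visits_le hω (by omega)
  omega

/-- Blocks of length twenty-six visit the surface at most four times (six-step law). [cite: MadrasSlade1993, Section 4.2, Definition 4.2.1] [cite: BeatonBousquetMelouDeGierDuminilCopinGuttmann2014, Section 3.1 (arXiv v5 p. 8)] -/
theorem visits_le_four_of_mem_ipwb_twentysix {m : ℕ} (hm : m = 26) {ω : ℕ → Site 2} (hω : ω ∈ ipwb m) : visits m ω ≤ 4 := by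
  have := six_mul_visits_le hω (by omega)
  omega

/-- ★★★ **`Λ₂₂(y) = 738y + 295y² + 33y³`**: the row `s = 11` of the wall-renewal census is complete (symbolic length).
[cite: MadrasSlade1993, Section 4.2, (4.2.2) (p. 91)] [cite: Kesten1963SAW, Section 4] -/
theorem IPWB_twentytwo_eq_exact {m : ℕ} (hm : m = 22) (y : ℝ) : IPWB m y = 738 * y + 295 * y ^ 2 + 33 * y ^ 3 := by
  classical
  rw [IPWB_eq_sum_range_card_mul_pow_nb (K := 3) (fun ω hω => visits_le_three_of_mem_ipwb_twentytwo hm hω)]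
  simp only [Finset.sum_range_succ, Finset.sum_range_zero, card_zeroVisit_ipwb_eq_zero_nb, card_oneVisit_ipwb_twentytwo_eq hm,
    card_twoVisit_ipwb_twentytwo_eq hm, card_threeVisit_ipwb_twentytwo_eq_thirtyThree hm]
  norm_num

/-- ★★ **`#(ipwb 22) = 1066`** (`738 + 295 + 33`; symbolic length). [cite: MadrasSlade1993, Section 4.2, Definition 4.2.1, (4.2.2)] [cite: Kesten1963SAW, Section 4] -/
theorem card_ipwb_twentytwo_eq {m : ℕ} (hm : m = 22) : #(ipwb m) = 1066 := by
  classical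
  rw [card_ipwb_eq_sum_range_card (K := 3) (fun ω hω => visits_le_three_of_mem_ipwb_twentytwo hm hω)]
  simp only [Finset.sum_range_succ, Finset.sum_range_zero, card_zeroVisit_ipwb_eq_zero_nb, card_oneVisit_ipwb_twentytwo_eq hm,
    card_twoVisit_ipwb_twentytwo_eq hm, card_threeVisit_ipwb_twentytwo_eq_thirtyThree hm]

/-- ★★ **`f₁₁(y) = (738y + 295y² + 33y³)/β(y)²²`** — the renewal law is explicit through half-length eleven. [cite: MadrasSlade1993, Section 4.2, (4.2.2), (4.2.4) (p. 91)] -/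
theorem pwbLaw_eleven_eq_exact (y : ℝ) : pwbLaw y 11 = (738 * y + 295 * y ^ 2 + 33 * y ^ 3) / wallRate y ^ 22 := by
  obtain ⟨m, hm⟩ : ∃ m : ℕ, m = 22 := ⟨_, rfl⟩
  have e : pwbLaw y 11 = IPWB m y / wallRate y ^ m := by rw [pwbLaw, hm]
  rw [e, IPWB_twentytwo_eq_exact hm, hm]

/-! ### §3  The rows `s = 12, 13` with the diagonal-ten classes symbolic -/

open Classical in
/-- ★ **`Λ₂₄(y) = N₁₂,₁·y + N₁₂,₂·y² + 132y³ + y⁴`** (`N₁₂,₁`, `N₁₂,₂` symbolic: diagonals `11`, `10`). [cite: MadrasSlade1993, Section 4.2, (4.2.2) (p. 91)] [cite: Kesten1963SAW, Section 4] -/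
theorem IPWB_twentyfour_eq_census {m : ℕ} (hm : m = 24) (y : ℝ) :
    IPWB m y = #((ipwb m).filter fun ω => visits m ω = 1) * y + #((ipwb m).filter fun ω => visits m ω = 2) * y ^ 2 + 132 * y ^ 3 + y ^ 4 := by
  rw [IPWB_eq_sum_range_card_mul_pow_nb (K := 4) (fun ω hω => visits_le_four_of_mem_ipwb_twentyfour hm hω)]
  simp only [Finset.sum_range_succ, Finset.sum_range_zero, card_zeroVisit_ipwb_eq_zero_nb, card_threeVisit_ipwb_twentyfour_eq hm,
    card_fourVisit_ipwb_twentyfour_eq_one hm]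
  norm_num

open Classical in
/-- ★ **`Λ₂₆(y) = N₁₃,₁·y + N₁₃,₂·y² + N₁₃,₃·y³ + 16y⁴`** (`N₁₃,₁`, `N₁₃,₂`, `N₁₃,₃` symbolic: diagonals `12`, `11`, `10`). [cite: MadrasSlade1993, Section 4.2, (4.2.2) (p. 91)] [cite: Kesten1963SAW, Section 4] -/
theorem IPWB_twentysix_eq_census {m : ℕ} (hm : m = 26) (y : ℝ) :
    IPWB m y = #((ipwb m).filter fun ω => visits m ω = 1) * y + #((ipwb m).filter fun ω => visits m ω = 2) * y ^ 2 +
      #((ipwb m).filter fun ω => visits m ω = 3) * y ^ 3 + 16 * y ^ 4 := by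
  rw [IPWB_eq_sum_range_card_mul_pow_nb (K := 4) (fun ω hω => visits_le_four_of_mem_ipwb_twentysix hm hω)]
  simp only [Finset.sum_range_succ, Finset.sum_range_zero, card_zeroVisit_ipwb_eq_zero_nb, card_fourVisit_ipwb_twentysix_eq hm]
  norm_num

open Classical in
/-- ★★ **The diagonal `s − v = 9` sums to `710`**: `N₁₀,₁ + N₁₁,₂ + N₁₂,₃ + N₁₃,₄ = 267 + 295 + 132 + 16` (with «CENSUS-NINE-A»'s `N₁₀,₁ = 267`; lengths symbolic).
[cite: MadrasSlade1993, Section 4.2, Definition 4.2.1, (4.2.2)] [cite: Kesten1963SAW, Section 4] -/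
theorem diagonal_nine_sum_eq {m₁ m₂ m₃ m₄ : ℕ} (h₁ : m₁ = 20) (h₂ : m₂ = 22) (h₃ : m₃ = 24) (h₄ : m₄ = 26) :
    #((ipwb m₁).filter fun ω => visits m₁ ω = 1) + #((ipwb m₂).filter fun ω => visits m₂ ω = 2) +
      #((ipwb m₃).filter fun ω => visits m₃ ω = 3) + #((ipwb m₄).filter fun ω => visits m₄ ω = 4) = 710 := by
  classical
  rw [card_oneVisit_ipwb_twenty_eq_twoSixtySeven h₁, card_twoVisit_ipwb_twentytwo_eq h₂, card_threeVisit_ipwb_twentyfour_eq h₃,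
    card_fourVisit_ipwb_twentysix_eq h₄]

end Literature.Probability.RandomPlanarGeometry.SAW.HexBW.Wall
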